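import Summits.NavierStokesRegularity.NavierStokesRegularity.Theses.AxisymmetricExtremality
import Literature.Analysis.FluidPDE.AxisymOuterBounds
import Literature.Analysis.FluidPDE.AxisymQuotientEquationsJ
import Literature.Analysis.FluidPDE.AxisymGradientField
import Literature.Analysis.FluidPDE.AxisymPoloidalMoments
import Literature.Analysis.FluidPDE.AxisymPoloidalCutoff
import HarnessLib

/-!
# Seregin 2022, §2 Step 1: the pointwise estimates behind "`v`, `∇v`, `∇²v` are bounded on
# `supp |∇η|`" — infinitesimal bounds for `v_θ`, `∇(v_r/r)`, `∂₃(v_r/r)`, `(∂ᵣT)/r` —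
# crux stmt-NavierStokesRegularity-15453 (`AxisymmetricExtremality.AxisymmetricKatoGlobal`), line registered, support for stub `stub_sereginLogSwirlOrigin`

Support file (`--supports stmt-NavierStokesRegularity-15453`; theorems only, everything proved)
toward the registered stub `stub_sereginLogSwirlOrigin` = the named fact
`Literature.Analysis.FluidPDE.seregin2022_logSwirl_regularAtOrigin` (G. Seregin, J. Math. Fluid
Mech. 24 (2022), Paper 27 = arXiv:2201.00153, §2).  The Step-3 key estimate
(`cutoff_energy_keyEstimate_unconditional`, `…Step3KeyUnconditional.lean`) and the Step-4
assembly (`isRegularAtOrigin_of_step3Bounds`, `…Step4Assembly.lean`) consume numeric constants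
`M, Bcut, P₀, …, P₄, L` bounding, on `supp ∇ζ ∪ {ϱ ≥ r₁}`, products of the cut-off `ζ = η³`,
the velocity `v`, `v_θ`, `v_r/r`, `∇(v_r/r)`, `∂₃(v_r/r)`, `Γ = ω_θ/r`, `Φ = ω_r/r`, `(∂ᵣ·)/r`;
the paper (arXiv p. 5, Step 1 and proof of Lemma 2.1) takes them from "In the set `supp |∇η|`,
functions `v`, `∇v`, and `∇²v` are bounded … These terms contain `v₃`, `v_{r,3}`, `v_{3,r}`,
`v_{3,rr}`, `v_{3,r}/r`, `v_{r,3r}`, and `v_{r,3}/r`. All of them are bounded by either `|v|`, or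
`|∇v|`, or `|∇²v|`."  This file proves the POINTWISE form of that remark for the quantities
with a `1/r`: each is bounded at `x` by the derivatives of `v` AT `x` (infinitesimal
axisymmetry), so that sup-norm bounds of `v, Dv, D²v` on a set transfer verbatim:

* `norm_fderiv_fderiv_apply_le` — `‖D(y ↦ Df(y)v)(x)‖ ≤ ‖v‖ ‖D²f(x)‖`;
* `abs_swirlVelocity_le_cylRadius_mul` — **`|v_θ(x)| ≤ ϱ ‖Dv(x)‖`**;
* `norm_fderiv_radVelQuot_le_four_mul_div` — **`‖∇(v_r/r)(x)‖ ≤ 4‖Dv(x)‖/ϱ`**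
  off the axis (sharper than the tree's `3‖v‖/ϱ² + ‖Dv‖/ϱ`: the horizontal velocity is itself
  `≤ ϱ‖Dv‖`), whence
* `abs_swirlVelocity_mul_norm_fderiv_radVelQuot_le` —
  **`|v_θ(x)| ‖∇(v_r/r)(x)‖ ≤ 4‖Dv(x)‖²` at every `x`** (the `1/ϱ` cancels; the product entering
  `P₀` and `P₂`);
* `fderiv_radVelQuot_single_two`, `abs_fderiv_radVelQuot_single_two_le` —
  **`∂₃(v_r/r) = (∂₃v)_r/r`** and **`|∂₃(v_r/r)(x)| ≤ ‖D²v(x)‖`** (the paper's `v_{r,3}/r`);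
* `abs_radDerivQuot_le_norm_iteratedFDeriv_two` — **`|(∂ᵣT)/r (x)| ≤ ‖D²T(x)‖`** for an
  axisymmetric scalar `T ∈ C³` (the identity `(∂ᵣT)/ϱ = D²T(x)[e_θ, e_θ]`; the paper's
  `v_{3,r}/r` for `T = v₃`, and `q_{∇ζ·v}` of `P₄`).

## Mathlib / tree search

Tree: `IsAxisymmetric.abs_swirl_le_mul_norm_fderiv`, `…sqrt_sq_add_sq_le_mul_norm_fderiv`,
`…abs_radVelQuot_le_norm_fderiv`, `…fderiv_angVelQuot_single_two` (pattern), `le_of_le_off_axis`,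
`eq_of_eq_off_axis` (`AxisymQuotientBounds`); `IsAxisymmetric.norm_fderiv_radVelQuot_le`
(`AxisymOuterBounds`, the cruder off-axis bound); `fderiv_horizontal_inner_apply`
(`AxisymQuotientEquationsJ`); `fderiv_rho_apply`, `contDiff_horizSq`; `mul_radDerivQuot_eq_fderiv_zero/one`,
`contDiff_radDerivQuot` (`AxisymRadialQuotient`); `fderiv_fderiv_apply_eq_fderiv_fderiv`
(`AxisymGradientField`). Mathlib: `norm_iteratedFDeriv_clm_apply_const`, `norm_iteratedFDeriv_one`,
`norm_iteratedFDeriv_fderiv`, `iteratedFDeriv_two_apply`, `ContinuousMultilinearMap.le_opNorm`;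
tree `abs_horizontal_inner_le_cylRadius_mul` (`AxisymPoloidalMoments`), `abs_swirlVelocity_le`
(`AxisymPoloidalCutoff`). `lean search 'radVelQuot_single_two|le_cylRadius_mul|iteratedFDeriv_two' --decl`
in this namespace: no matches (2026-08-17).

## References

* G. Seregin, J. Math. Fluid Mech. 24 (2022), Paper No. 27 = arXiv:2201.00153, §2 Step 1 and
  proof of Lemma 2.1 (arXiv p. 5: boundedness of `v, ∇v, ∇²v` on `supp |∇η|`). [`Seregin2022LocalAxisym`]
-/

noncomputable section

open Set Filter Topology Function Metric
open scoped ContDiff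
open Literature.Analysis.FluidPDE

-- `<Problem> = <Summit>` duplicates a namespace component by design (lakefile sets the same option).
set_option linter.dupNamespace false

namespace Summit.NavierStokesRegularity.NavierStokesRegularity.Theorems.AxisymmetricKatoGlobal.EulerScaling

/-! ### A general tool -/

section General

variable {F' : Type*} [NormedAddCommGroup F'] [NormedSpace ℝ F']

/-- **`‖D(y ↦ Df(y) v)(x)‖ ≤ ‖v‖ ‖D²f(x)‖`** for `f ∈ C²` (the directional derivative `y ↦ Df(y)v`
is `Df` paired with a constant vector). [folklore] -/
theorem norm_fderiv_fderiv_apply_le {f : EuclideanSpace ℝ (Fin 3) → F'} (hf : ContDiff ℝ 2 f)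
    (x v : EuclideanSpace ℝ (Fin 3)) :
    ‖fderiv ℝ (fun y => fderiv ℝ f y v) x‖ ≤ ‖v‖ * ‖iteratedFDeriv ℝ 2 f x‖ := by
  have h := norm_iteratedFDeriv_clm_apply_const (𝕜 := ℝ) (f := fderiv ℝ f) (c := v) (x := x)
    (N := 1) (n := 1) ((hf.fderiv_right (m := 1) (by norm_num)).contDiffAt) le_rfl
  rw [norm_iteratedFDeriv_one, norm_iteratedFDeriv_fderiv] at h
  exact h

end General

/-! ### The swirl velocity -/

section Velocity

variable {u : EuclideanSpace ℝ (Fin 3) → EuclideanSpace ℝ (Fin 3)} {x : EuclideanSpace ℝ (Fin 3)}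

/-- **`|v_θ(x)| ≤ ϱ(x) ‖Dv(x)‖`** for an axisymmetric field differentiable at `x`: off the axis
`v_θ = σ/ϱ` with `|σ| ≤ ϱ²‖Dv‖` (`IsAxisymmetric.abs_swirl_le_mul_norm_fderiv`); on the axis both
sides vanish (`e_θ = 0` there). In particular `v_θ` vanishes on the axis to first order, which is
what cancels the `1/ϱ` of `∇(v_r/r)` in the Step-3 constants. [folklore] -/
theorem abs_swirlVelocity_le_cylRadius_mul (hax : IsAxisymmetric u)
    (hd : DifferentiableAt ℝ u x) : |swirlVelocity u x| ≤ cylRadius x * ‖fderiv ℝ u x‖ := by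
  by_cases hx : cylRadius x = 0
  · have h1 : swirlVelocity u x = 0 := by simp [swirlVelocity, eTheta, hx]
    rw [h1, hx, abs_zero, zero_mul]
  · have hr : 0 < cylRadius x := lt_of_le_of_ne (cylRadius_nonneg x) (Ne.symm hx)
    have h := hax.abs_swirl_le_mul_norm_fderiv hd
    rw [swirl_eq_cylRadius_mul_swirlVelocity u hx, abs_mul, abs_of_pos hr, pow_two, mul_assoc] at h
    exact le_of_mul_le_mul_left h hr

end Velocity

/-! ### The gradient of `v_r/r` -/

section RadVel

variable {u : EuclideanSpace ℝ (Fin 3) → EuclideanSpace ℝ (Fin 3)} {x : EuclideanSpace ℝ (Fin 3)}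

/-- **`‖∇(v_r/r)(x)‖ ≤ 4‖Dv(x)‖/ϱ` off the axis**, for an axisymmetric `v ∈ C³`: differentiate
`ϱ² · (v_r/r) = x₀v₀ + x₁v₁` (`D(v_r/r)[h] = (D⟪x_h, v⟫[h] − 2⟪x_h, h_h⟩(v_r/r))/ϱ²`) and use the
infinitesimal bounds `|v_h| ≤ ϱ‖Dv‖`, `|v_r/r| ≤ ‖Dv‖`, so that
`|D⟪x_h,v⟫[h]| ≤ ‖h‖(|v_h| + ϱ‖Dv‖) ≤ 2ϱ‖Dv‖‖h‖` and `|2⟪x_h,h_h⟩(v_r/r)| ≤ 2ϱ‖Dv‖‖h‖`.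
(Lei–Zhang's "`∇(vʳ/r) = ∇vʳ/r − e_r vʳ/r²`"; compare `IsAxisymmetric.norm_fderiv_radVelQuot_le`.)
[folklore] -/
theorem norm_fderiv_radVelQuot_le_four_mul_div (hax : IsAxisymmetric u)
    (hu : ContDiff ℝ 3 u) (hx : cylRadius x ≠ 0) :
    ‖fderiv ℝ (radVelQuot u) x‖ ≤ 4 * ‖fderiv ℝ u x‖ / cylRadius x := by
  have hr : 0 < cylRadius x := lt_of_le_of_ne (cylRadius_nonneg x) (Ne.symm hx)
  have hu2 : ContDiff ℝ 2 u := hu.of_le (by norm_num)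
  have hud : Differentiable ℝ u := hu.differentiable (by norm_num)
  have hW1 : ContDiff ℝ 1 (radVelQuot u) := contDiff_radVelQuot (n := 1) (by exact_mod_cast hu)
  have hWd : Differentiable ℝ (radVelQuot u) := hW1.differentiable one_ne_zero
  have hρd : Differentiable ℝ (fun y : EuclideanSpace ℝ (Fin 3) => y 0 ^ 2 + y 1 ^ 2) :=
    contDiff_horizSq.differentiable two_ne_zero
  -- `ϱ² W = ⟪x_h, v⟫` as functions
  have hprod : (fun y : EuclideanSpace ℝ (Fin 3) => (y 0 ^ 2 + y 1 ^ 2) * radVelQuot u y) =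
      fun y => y 0 * u y 0 + y 1 * u y 1 := by
    funext y
    rw [← cylRadius_sq, hax.cylRadius_sq_mul_radVelQuot hu2 y]
  -- the derivative identity applied to `h`
  have hid : ∀ h : EuclideanSpace ℝ (Fin 3), 2 * (x 0 * h 0 + x 1 * h 1) * radVelQuot u x +
      cylRadius x ^ 2 * fderiv ℝ (radVelQuot u) x h =
      h 0 * u x 0 + h 1 * u x 1 + (x 0 * fderiv ℝ u x h 0 + x 1 * fderiv ℝ u x h 1) := by
    intro h
    have e := congrArg (fun f : EuclideanSpace ℝ (Fin 3) → ℝ => fderiv ℝ f x h) hprod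
    simp only at e
    rw [fderiv_fun_mul (hρd x) (hWd x), fderiv_horizontal_inner_apply (hud x)] at e
    simp only [_root_.add_apply, _root_.FunLike.coe_smul, Pi.smul_apply, smul_eq_mul,
      fderiv_rho_apply] at e
    rw [cylRadius_sq]
    linarith
  -- the infinitesimal bounds at `x`
  have hWb : |radVelQuot u x| ≤ ‖fderiv ℝ u x‖ := hax.abs_radVelQuot_le_norm_fderiv hu2 x
  have hvh : cylRadius (u x) ≤ cylRadius x * ‖fderiv ℝ u x‖ :=
    hax.sqrt_sq_add_sq_le_mul_norm_fderiv (hud x)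
  have hbound : ∀ h : EuclideanSpace ℝ (Fin 3), ‖fderiv ℝ (radVelQuot u) x h‖ ≤
      4 * ‖fderiv ℝ u x‖ / cylRadius x * ‖h‖ := by
    intro h
    have hD0 : 0 ≤ ‖fderiv ℝ u x‖ := norm_nonneg _
    have hh : |x 0 * h 0 + x 1 * h 1| ≤ cylRadius x * ‖h‖ := abs_horizontal_inner_le_cylRadius_mul x h
    have h1 : |h 0 * u x 0 + h 1 * u x 1| ≤ cylRadius x * ‖fderiv ℝ u x‖ * ‖h‖ := by
      have e1 : h 0 * u x 0 + h 1 * u x 1 = u x 0 * h 0 + u x 1 * h 1 := by ring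
      rw [e1]
      exact (abs_horizontal_inner_le_cylRadius_mul (u x) h).trans
        (mul_le_mul_of_nonneg_right hvh (norm_nonneg _))
    have h2 : |x 0 * fderiv ℝ u x h 0 + x 1 * fderiv ℝ u x h 1| ≤ cylRadius x * (‖fderiv ℝ u x‖ * ‖h‖) :=
      (abs_horizontal_inner_le_cylRadius_mul x (fderiv ℝ u x h)).trans
        (mul_le_mul_of_nonneg_left ((fderiv ℝ u x).le_opNorm h) (cylRadius_nonneg x))
    have h3 : |2 * (x 0 * h 0 + x 1 * h 1) * radVelQuot u x| ≤ 2 * (cylRadius x * ‖h‖) * ‖fderiv ℝ u x‖ := by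
      rw [abs_mul, abs_mul, abs_two]
      gcongr
    -- from `hid`: `ϱ² D W h = RHS − 2⟪x_h,h_h⟩ W`
    have e : fderiv ℝ (radVelQuot u) x h = (h 0 * u x 0 + h 1 * u x 1 +
        (x 0 * fderiv ℝ u x h 0 + x 1 * fderiv ℝ u x h 1) -
        2 * (x 0 * h 0 + x 1 * h 1) * radVelQuot u x) / cylRadius x ^ 2 := by
      have := hid h
      field_simp
      linarith
    rw [e, Real.norm_eq_abs, abs_div, abs_of_pos (pow_pos hr 2), div_le_iff₀ (pow_pos hr 2)]
    calc |h 0 * u x 0 + h 1 * u x 1 + (x 0 * fderiv ℝ u x h 0 + x 1 * fderiv ℝ u x h 1) -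
          2 * (x 0 * h 0 + x 1 * h 1) * radVelQuot u x|
        ≤ |h 0 * u x 0 + h 1 * u x 1| + |x 0 * fderiv ℝ u x h 0 + x 1 * fderiv ℝ u x h 1| +
          |2 * (x 0 * h 0 + x 1 * h 1) * radVelQuot u x| := by
            refine (abs_sub _ _).trans ?_
            gcongr
            exact abs_add_le _ _
      _ ≤ cylRadius x * ‖fderiv ℝ u x‖ * ‖h‖ + cylRadius x * (‖fderiv ℝ u x‖ * ‖h‖) +
          2 * (cylRadius x * ‖h‖) * ‖fderiv ℝ u x‖ := by gcongr
      _ = 4 * ‖fderiv ℝ u x‖ / cylRadius x * ‖h‖ * cylRadius x ^ 2 := by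
            field_simp
            ring
  exact ContinuousLinearMap.opNorm_le_bound _ (by positivity) hbound

/-- **`|v_θ(x)| ‖∇(v_r/r)(x)‖ ≤ 4‖Dv(x)‖²` at every point**, for an axisymmetric `v ∈ C³`: off
the axis by `|v_θ| ≤ ϱ‖Dv‖` and `‖∇(v_r/r)‖ ≤ 4‖Dv‖/ϱ`; on the axis `v_θ = 0`. This is the
pointwise content of the Step-3 constants `P₀` (far field) and `P₂` (on `supp ∇ζ`, which crosses
the axis near the two heights). [cite: Seregin2022LocalAxisym, §2 Step 1 (arXiv:2201.00153 p. 5), boundedness of v, ∇v, ∇²v on supp|∇η|] -/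
theorem abs_swirlVelocity_mul_norm_fderiv_radVelQuot_le : ∀ (u : EuclideanSpace ℝ (Fin 3) → EuclideanSpace ℝ (Fin 3)), IsAxisymmetric u → ContDiff ℝ 3 u → ∀ x : EuclideanSpace ℝ (Fin 3), |swirlVelocity u x| * ‖fderiv ℝ (radVelQuot u) x‖ ≤ 4 * ‖fderiv ℝ u x‖ ^ 2 := by
  intro u hax hu x
  have hud : Differentiable ℝ u := hu.differentiable (by norm_num)
  by_cases hx : cylRadius x = 0
  · have h1 : swirlVelocity u x = 0 := by simp [swirlVelocity, eTheta, hx]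
    rw [h1, abs_zero, zero_mul]
    positivity
  · have hr : 0 < cylRadius x := lt_of_le_of_ne (cylRadius_nonneg x) (Ne.symm hx)
    calc |swirlVelocity u x| * ‖fderiv ℝ (radVelQuot u) x‖
        ≤ (cylRadius x * ‖fderiv ℝ u x‖) * (4 * ‖fderiv ℝ u x‖ / cylRadius x) :=
          mul_le_mul (abs_swirlVelocity_le_cylRadius_mul hax (hud x))
            (norm_fderiv_radVelQuot_le_four_mul_div hax hu hx) (norm_nonneg _) (by positivity)
      _ = 4 * ‖fderiv ℝ u x‖ ^ 2 := by
          field_simp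

/-- **`∂₃(v_r/r) = (∂₃v)_r/r`**: the axial derivative commutes with the quotient `radVelQuot`,
for an axisymmetric `v ∈ C³`, at every point (off the axis differentiate
`ϱ² · (v_r/r) = x₀v₀ + x₁v₁` along `e₃`, across the axis by continuity; compare
`IsAxisymmetric.fderiv_angVelQuot_single_two`). [folklore] -/
theorem fderiv_radVelQuot_single_two (hax : IsAxisymmetric u) (hu : ContDiff ℝ 3 u)
    (x : EuclideanSpace ℝ (Fin 3)) :
    fderiv ℝ (radVelQuot u) x (EuclideanSpace.single 2 1) =
      radVelQuot (fun y => fderiv ℝ u y (EuclideanSpace.single 2 1)) x := by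
  have hu2 : ContDiff ℝ 2 u := hu.of_le (by norm_num)
  have hud : Differentiable ℝ u := hu.differentiable (by norm_num)
  have hW1 : ContDiff ℝ 1 (radVelQuot u) := contDiff_radVelQuot (n := 1) (by exact_mod_cast hu)
  have hWd : Differentiable ℝ (radVelQuot u) := hW1.differentiable one_ne_zero
  have huz : ContDiff ℝ 2 (fun y => fderiv ℝ u y (EuclideanSpace.single 2 1)) :=
    contDiff_fderiv_apply_const_succ (n := 2) (by exact_mod_cast hu) _
  have haxz : IsAxisymmetric (fun y => fderiv ℝ u y (EuclideanSpace.single 2 1)) :=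
    hax.fderiv_apply_single_two hud
  have hL : Continuous fun y => fderiv ℝ (radVelQuot u) y (EuclideanSpace.single 2 1) :=
    (hW1.continuous_fderiv one_ne_zero).clm_apply continuous_const
  have hR : Continuous (radVelQuot fun y => fderiv ℝ u y (EuclideanSpace.single 2 1)) :=
    (contDiff_radVelQuot (n := 0) (by exact_mod_cast huz)).continuous
  refine eq_of_eq_off_axis hL hR (fun z hz => ?_) x
  have hr2 : cylRadius z ^ 2 ≠ 0 := pow_ne_zero 2 hz
  apply mul_left_cancel₀ hr2
  rw [haxz.cylRadius_sq_mul_radVelQuot huz z]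
  have hprod : (fun y : EuclideanSpace ℝ (Fin 3) => y 0 * u y 0 + y 1 * u y 1) =
      fun y => (y 0 ^ 2 + y 1 ^ 2) * radVelQuot u y := by
    funext y
    rw [← cylRadius_sq, hax.cylRadius_sq_mul_radVelQuot hu2 y]
  have hρd : DifferentiableAt ℝ (fun y : EuclideanSpace ℝ (Fin 3) => y 0 ^ 2 + y 1 ^ 2) z :=
    contDiff_horizSq.differentiable two_ne_zero z
  have e := congrArg (fun f : EuclideanSpace ℝ (Fin 3) → ℝ => fderiv ℝ f z (EuclideanSpace.single 2 1)) hprod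
  simp only at e
  rw [fderiv_horizontal_inner_apply (hud z), fderiv_fun_mul hρd (hWd z)] at e
  simp only [_root_.add_apply, _root_.FunLike.coe_smul, Pi.smul_apply, smul_eq_mul,
    fderiv_rho_apply, cylRadius_sq] at e ⊢
  simp at e
  linarith

/-- **`|∂₃(v_r/r)(x)| ≤ ‖D²v(x)‖`** for an axisymmetric `v ∈ C³` (the paper's `v_{r,3}/r`):
`∂₃(v_r/r) = (∂₃v)_r/r` and `|w_r/r| ≤ ‖Dw‖` for the axisymmetric field `w = ∂₃v`. [cite: Seregin2022LocalAxisym, §2 proof of Lemma 2.1 (arXiv:2201.00153 p. 5), the term v_{r,3}/r] -/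
theorem abs_fderiv_radVelQuot_single_two_le (hax : IsAxisymmetric u)
    (hu : ContDiff ℝ 3 u) (x : EuclideanSpace ℝ (Fin 3)) :
    |fderiv ℝ (radVelQuot u) x (EuclideanSpace.single 2 1)| ≤ ‖iteratedFDeriv ℝ 2 u x‖ := by
  have hu2 : ContDiff ℝ 2 u := hu.of_le (by norm_num)
  have hud : Differentiable ℝ u := hu.differentiable (by norm_num)
  have huz : ContDiff ℝ 2 (fun y => fderiv ℝ u y (EuclideanSpace.single 2 1)) :=
    contDiff_fderiv_apply_const_succ (n := 2) (by exact_mod_cast hu) _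
  have haxz : IsAxisymmetric (fun y => fderiv ℝ u y (EuclideanSpace.single 2 1)) :=
    hax.fderiv_apply_single_two hud
  rw [fderiv_radVelQuot_single_two hax hu x]
  calc |radVelQuot (fun y => fderiv ℝ u y (EuclideanSpace.single 2 1)) x|
      ≤ ‖fderiv ℝ (fun y => fderiv ℝ u y (EuclideanSpace.single 2 1)) x‖ :=
        haxz.abs_radVelQuot_le_norm_fderiv huz x
    _ ≤ ‖(EuclideanSpace.single 2 1 : EuclideanSpace ℝ (Fin 3))‖ * ‖iteratedFDeriv ℝ 2 u x‖ :=
        norm_fderiv_fderiv_apply_le hu2 x _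
    _ = ‖iteratedFDeriv ℝ 2 u x‖ := by simp

end RadVel

/-! ### The radial derivative quotient of an axisymmetric scalar -/

section RadDeriv

/-- **`|(∂ᵣT)/ϱ (x)| ≤ ‖D²T(x)‖`** for an axisymmetric scalar `T ∈ C³`, at every point (the
paper's `v_{3,r}/r`, and the quotient `q_{∇ζ·v}` of `P₄`). Off the axis, with
`h₀ = (-x₁, x₀, 0)` (`= ϱ e_θ`): `DT(y)[h₀] = (x₀y₁ − x₁y₀) q(y)` by `xᵢ q = ∂ᵢT`
(`q = radDerivQuot T`), so `D²T(x)[h₀, h₀] = ϱ² q(x)`, i.e. `q = D²T[e_θ, e_θ]` — the angular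
eigenvalue of the horizontal Hessian; across the axis by continuity. [folklore] -/
theorem abs_radDerivQuot_le_norm_iteratedFDeriv_two : ∀ (T : EuclideanSpace ℝ (Fin 3) → ℝ), ContDiff ℝ 3 T → IsAxisymmetricScalar T → ∀ x : EuclideanSpace ℝ (Fin 3), |radDerivQuot T x| ≤ ‖iteratedFDeriv ℝ 2 T x‖ := by
  intro T hT hax x
  have hT2 : ContDiff ℝ 2 T := hT.of_le (by norm_num)
  have hq1 : ContDiff ℝ 1 (radDerivQuot T) := contDiff_radDerivQuot (n := 1) (by exact_mod_cast hT)
  have hqd : Differentiable ℝ (radDerivQuot T) := hq1.differentiable one_ne_zero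
  have hqc : Continuous (radDerivQuot T) := hq1.continuous
  have hc2 : Continuous fun y => ‖iteratedFDeriv ℝ 2 T y‖ :=
    (hT2.continuous_iteratedFDeriv le_rfl).norm
  refine le_of_le_off_axis (continuous_abs.comp hqc) hc2 (fun z hz => ?_) x
  have hr : 0 < cylRadius z := lt_of_le_of_ne (cylRadius_nonneg z) (Ne.symm hz)
  -- the fixed horizontal vector `h₀ = (-z₁, z₀, 0)`
  set h₀ : EuclideanSpace ℝ (Fin 3) :=
    (-z 1) • EuclideanSpace.single 0 1 + (z 0) • EuclideanSpace.single 1 1 with hh₀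
  have h₀0 : h₀ 0 = -z 1 := by simp [hh₀]
  have h₀1 : h₀ 1 = z 0 := by simp [hh₀]
  have hnorm : ‖h₀‖ ^ 2 = cylRadius z ^ 2 := by
    rw [EuclideanSpace.norm_sq_eq, cylRadius_sq]
    simp [hh₀, Fin.sum_univ_three]
    ring
  -- `DT(y)[h₀] = (z₀y₁ − z₁y₀) q(y)`
  have hg : ∀ y, fderiv ℝ T y h₀ = (z 0 * y 1 - z 1 * y 0) * radDerivQuot T y := by
    intro y
    rw [hh₀, map_add, map_smul, map_smul, smul_eq_mul, smul_eq_mul,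
      ← mul_radDerivQuot_eq_fderiv_zero hT2 hax y, ← mul_radDerivQuot_eq_fderiv_one hT2 hax y]
    ring
  have hgfun : (fun y => fderiv ℝ T y h₀) = fun y => (z 0 * y 1 - z 1 * y 0) * radDerivQuot T y :=
    funext hg
  -- differentiate at `z` along `h₀`
  have hlin : DifferentiableAt ℝ (fun y : EuclideanSpace ℝ (Fin 3) => z 0 * y 1 - z 1 * y 0) z :=
    (((EuclideanSpace.proj (𝕜 := ℝ) (1 : Fin 3)).differentiableAt).const_mul _).sub
      (((EuclideanSpace.proj (𝕜 := ℝ) (0 : Fin 3)).differentiableAt).const_mul _)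
  have hlin' : fderiv ℝ (fun y : EuclideanSpace ℝ (Fin 3) => z 0 * y 1 - z 1 * y 0) z h₀ =
      z 0 * h₀ 1 - z 1 * h₀ 0 := by
    have hc : ∀ i : Fin 3, DifferentiableAt ℝ (fun y : EuclideanSpace ℝ (Fin 3) => y i) z := fun i =>
      (EuclideanSpace.proj (𝕜 := ℝ) i).differentiableAt
    have hcf : ∀ (i : Fin 3) (h : EuclideanSpace ℝ (Fin 3)),
        fderiv ℝ (fun y : EuclideanSpace ℝ (Fin 3) => y i) z h = h i := fun i h => by
      have : (fun y : EuclideanSpace ℝ (Fin 3) => y i) = ⇑(EuclideanSpace.proj (𝕜 := ℝ) i) := rfl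
      rw [this, ContinuousLinearMap.fderiv]; rfl
    rw [fderiv_fun_sub ((hc 1).const_mul _) ((hc 0).const_mul _), fderiv_const_mul (hc 1),
      fderiv_const_mul (hc 0)]
    simp [hcf]
  have hD2 : fderiv ℝ (fun y => fderiv ℝ T y h₀) z h₀ = cylRadius z ^ 2 * radDerivQuot T z := by
    rw [hgfun, fderiv_fun_mul hlin (hqd z)]
    simp only [_root_.add_apply, _root_.FunLike.coe_smul, Pi.smul_apply, smul_eq_mul, hlin', h₀0, h₀1,
      cylRadius_sq]
    ring
  -- `D²T(z)[h₀, h₀]` against the operator norm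
  have hiter : iteratedFDeriv ℝ 2 T z ![h₀, h₀] = cylRadius z ^ 2 * radDerivQuot T z := by
    rw [iteratedFDeriv_two_apply]
    simp only [Matrix.cons_val_zero, Matrix.cons_val_one]
    rw [← fderiv_fderiv_apply_eq_fderiv_fderiv hT2 z h₀ h₀]
    exact hD2
  have hle : ‖iteratedFDeriv ℝ 2 T z ![h₀, h₀]‖ ≤ ‖iteratedFDeriv ℝ 2 T z‖ * cylRadius z ^ 2 := by
    refine ((iteratedFDeriv ℝ 2 T z).le_opNorm ![h₀, h₀]).trans (le_of_eq ?_)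
    rw [Fin.prod_univ_two]
    simp only [Matrix.cons_val_zero, Matrix.cons_val_one]
    rw [← pow_two, hnorm]
  rw [hiter, Real.norm_eq_abs, abs_mul, abs_of_pos (pow_pos hr 2), mul_comm] at hle
  exact le_of_mul_le_mul_right hle (pow_pos hr 2)

end RadDeriv

end Summit.NavierStokesRegularity.NavierStokesRegularity.Theorems.AxisymmetricKatoGlobal.EulerScaling

end
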